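import Summits.ResolutionOfSingularities.ResolutionOfSingularities.Theorems.RadicialJungCleanModelsSufficeGameEndStrata
import Summits.ResolutionOfSingularities.ResolutionOfSingularities.Theorems.RadicialJungCleanModelsSufficeGameEndTor
import Literature.AlgebraicGeometry.Resolution.IdealSheafLocalGenerator

/-!
# Route `RadicialJung`, crux `CleanModelsSuffice`, line `Sketch`: the END STATE of the game —
# the chart neighbourhood of a toroidal point and its boundary sections

Helper for the registered stub `stub_gameEndResolves` of the skeleton of
`Summit.ResolutionOfSingularities.ResolutionOfSingularities.Theses.RadicialJung.CleanModelsSuffice`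
(stmt-ResolutionOfSingularities-15883). At a toroidal point `v` of an end state `S` the boundary
germs `b v k` (`…GameEndTor`) generate the stalks at `v` of the GLOBAL charged exceptional divisors
`divOf k`; by the spreading lemma for ideal sheaves (`IdealSheafLocalGenerator.lean`) they extend to
sections `sec k` of an affine open `U' v ∋ v`, inside the good neighbourhood of `v`
(`…GameEndStrata`), which generate the stalks of the `divOf k` at EVERY point `w ∈ U' v` — so that
`w ∈ divOf k ↔ (sec k)_w ∈ 𝔪_w`. This file constructs `U' v`, `sec`, the germs `tw` and the values
`uC` in `L` of the sections, and the Kummer relation `yN^p = ∏ uC_k^{aK k} = ∏ (tw_k)^{aK k}` at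
every `w ∈ U' v`; and the Kummer chart of `v` with values in `L` (`kΦ`) and by sections of the
normalisation `V^L` over `U' v` (`kφ`, via `liftToSections`), with its values in `L` at germs
(`stalkToField_germ_kφ`).
-/

noncomputable section

set_option linter.dupNamespace false -- mandated namespace of this single-conjunct summit

open CategoryTheory AlgebraicGeometry TopologicalSpace IsLocalRing
open Literature.AlgebraicGeometry.Resolution

namespace Summit.ResolutionOfSingularities.ResolutionOfSingularities.Theorems.RadicialJung.CleanModelsSuffice

attribute [local instance] stalkAlgebra isScalarTower_stalkAlgebra sectionsAlgebra

namespace GameState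

variable {p : ℕ} {V₀ : Scheme.{0}} [IsIntegral V₀] {L : Type} [Field L] [Algebra V₀.functionField L]
  {V : Scheme.{0}} [IsIntegral V] {π : V ⟶ V₀} [IsDominant π] (S : GameState p V₀ L V π)
  [Algebra V.functionField L]

/-! ## The chart neighbourhood and the boundary sections -/

/-- **The chart neighbourhood of a toroidal point.** There are an affine open `U ∋ v` inside the
good neighbourhood of `v` and sections `s k ∈ Γ(V, U)` with germs `b v k` at `v`, generating the
stalk of `divOf k` at every point of `U`. [folklore] -/
theorem exists_chartNhd (H : S.EndHyp) {v : V} (hv : v ∈ S.tor) :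
    ∃ (U : V.Opens) (_ : IsAffineOpen U) (hvU : v ∈ U) (s : Fin (S.nC v + 1) → Γ(V, U)),
      (∀ w ∈ U, S.Near v w) ∧ (∀ k, V.presheaf.germ U v hvU (s k) = S.b H hv k) ∧
      (∀ k (w : V) (hw : w ∈ U),
        stalkIdeal (S.divOf H.endCond hv k).1 w = Ideal.span {V.presheaf.germ U w hw (s k)} ∧
        (w ∈ (S.divOf H.endCond hv k).1.support ↔
          V.presheaf.germ U w hw (s k) ∈ maximalIdeal (V.presheaf.stalk w))) := by
  classical
  haveI := H.locallyNoetherian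
  -- sections with the prescribed germs, on one affine open inside the good neighbourhood
  have h1 : ∀ k, ∃ (U : V.Opens) (m : v ∈ U) (f : Γ(V, U)), V.presheaf.germ U v m f = S.b H hv k :=
    fun k => TopCat.Presheaf.exists_germ_eq V.presheaf (S.b H hv k)
  choose U₁ hvU₁ f hf using h1
  obtain ⟨Un, hvUn, hUn⟩ := S.exists_nhds_near H.locallyNoetherian v
  set W : V.Opens := Un ⊓ ⟨⋂ k, (U₁ k : Set V), isOpen_iInter_of_finite fun k => (U₁ k).isOpen⟩
    with hW
  have hvW : v ∈ W := ⟨hvUn, Set.mem_iInter.mpr fun k => hvU₁ k⟩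
  have hWU₁ : ∀ k, W ≤ U₁ k := fun k w hw => Set.mem_iInter.mp hw.2 k
  obtain ⟨_, ⟨W₀, hW₀, rfl⟩, hvW₀, hW₀W⟩ :=
    V.isBasis_affineOpens.exists_subset_of_mem_open hvW W.isOpen
  set f₀ : Fin (S.nC v + 1) → Γ(V, W₀) := fun k =>
    V.presheaf.map (homOfLE ((hW₀W.trans (hWU₁ k)) : W₀ ≤ U₁ k)).op (f k) with hf₀
  have hf₀germ : ∀ k (w : V) (hw : w ∈ W₀), V.presheaf.germ W₀ w hw (f₀ k) =
      V.presheaf.germ (U₁ k) w ((hW₀W.trans (hWU₁ k)) hw) (f k) :=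
    fun k w hw => TopCat.Presheaf.germ_res_apply V.presheaf _ _ _ _
  -- spread each generator
  have h2 : ∀ k, ∃ (Wk : V.affineOpens) (hle : (Wk : V.Opens) ≤ W₀), v ∈ (Wk : V.Opens) ∧
      ∀ (w : V) (hw : w ∈ (Wk : V.Opens)),
        stalkIdeal (S.divOf H.endCond hv k).1 w =
          Ideal.span {(V.presheaf.germ W₀ w (hle hw)).hom (f₀ k)} ∧
        (w ∈ (S.divOf H.endCond hv k).1.support ↔
          (V.presheaf.germ W₀ w (hle hw)).hom (f₀ k) ∈ maximalIdeal (V.presheaf.stalk w)) := by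
    intro k
    refine exists_forall_stalkIdeal_eq_span_germ_and_mem_support_iff _ ⟨W₀, hW₀⟩ v hvW₀ (f₀ k) ?_
    change _ = Ideal.span {V.presheaf.germ W₀ v hvW₀ (f₀ k)}
    rw [hf₀germ, hf, S.stalkIdeal_divOf_eq_span_b H hv k]
  choose Wk hWk hvWk hspec using h2
  obtain ⟨_, ⟨U, hU, rfl⟩, hvU, hUle⟩ := V.isBasis_affineOpens.exists_subset_of_mem_open
    (Set.mem_iInter.mpr fun k => hvWk k : v ∈ ⋂ k, ((Wk k : V.Opens) : Set V))
    (isOpen_iInter_of_finite fun k => (Wk k : V.Opens).isOpen)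
  have hUWk : ∀ k, U ≤ (Wk k : V.Opens) := fun k w hw => Set.mem_iInter.mp (hUle hw) k
  have hUW₀ : U ≤ W₀ := fun w hw => hWk 0 (hUWk 0 hw)
  refine ⟨U, hU, hvU, fun k => V.presheaf.map (homOfLE hUW₀).op (f₀ k), ?_, ?_, ?_⟩
  · exact fun w hw => hUn w (hW₀W (hUW₀ hw)).1
  · intro k
    rw [TopCat.Presheaf.germ_res_apply, hf₀germ, hf]
  · intro k w hw
    have hg : V.presheaf.germ U w hw (V.presheaf.map (homOfLE hUW₀).op (f₀ k)) =
        (V.presheaf.germ W₀ w (hWk k (hUWk k hw))).hom (f₀ k) :=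
      TopCat.Presheaf.germ_res_apply V.presheaf _ _ _ _
    rw [hg]
    exact hspec k w (hUWk k hw)

/-- The chart domain `U' v` of a toroidal point. [folklore] -/
def U' (S : GameState p V₀ L V π) (H : S.EndHyp) {v : V} (hv : v ∈ S.tor) : V.Opens :=
  (S.exists_chartNhd H hv).choose

/-- `U' v` is affine. [folklore] -/
theorem isAffineOpen_U' (H : S.EndHyp) {v : V} (hv : v ∈ S.tor) : IsAffineOpen (S.U' H hv) :=
  (S.exists_chartNhd H hv).choose_spec.choose

/-- `v ∈ U' v`. [folklore] -/
theorem mem_U' (H : S.EndHyp) {v : V} (hv : v ∈ S.tor) : v ∈ S.U' H hv :=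
  (S.exists_chartNhd H hv).choose_spec.choose_spec.choose

/-- The boundary sections of the chart of `v`. [folklore] -/
def sec (S : GameState p V₀ L V π) (H : S.EndHyp) {v : V} (hv : v ∈ S.tor) :
    Fin (S.nC v + 1) → Γ(V, S.U' H hv) :=
  (S.exists_chartNhd H hv).choose_spec.choose_spec.choose_spec.choose

/-- The properties of the chart neighbourhood. [folklore] -/
theorem chartNhd_spec (H : S.EndHyp) {v : V} (hv : v ∈ S.tor) :
    (∀ w ∈ S.U' H hv, S.Near v w) ∧
      (∀ k, V.presheaf.germ (S.U' H hv) v (S.mem_U' H hv) (S.sec H hv k) = S.b H hv k) ∧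
      (∀ k (w : V) (hw : w ∈ S.U' H hv),
        stalkIdeal (S.divOf H.endCond hv k).1 w =
          Ideal.span {V.presheaf.germ (S.U' H hv) w hw (S.sec H hv k)} ∧
        (w ∈ (S.divOf H.endCond hv k).1.support ↔
          V.presheaf.germ (S.U' H hv) w hw (S.sec H hv k) ∈ maximalIdeal (V.presheaf.stalk w))) :=
  (S.exists_chartNhd H hv).choose_spec.choose_spec.choose_spec.choose_spec

/-- Points of the chart domain are in the good neighbourhood of `v`. [folklore] -/
theorem near_of_mem_U' (H : S.EndHyp) {v : V} (hv : v ∈ S.tor) {w : V} (hw : w ∈ S.U' H hv) :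
    S.Near v w :=
  (S.chartNhd_spec H hv).1 w hw

/-- `U' v` is non-empty. [folklore] -/
instance nonempty_U' (H : S.EndHyp) {v : V} (hv : v ∈ S.tor) : Nonempty (S.U' H hv) :=
  ⟨⟨v, S.mem_U' H hv⟩⟩

/-! ## Germs and values of the boundary sections -/

/-- The germs `tw_k` at `w ∈ U' v` of the boundary sections. [folklore] -/
def tw (S : GameState p V₀ L V π) (H : S.EndHyp) {v : V} (hv : v ∈ S.tor) (w : V)
    (hw : w ∈ S.U' H hv) (k : Fin (S.nC v + 1)) : V.presheaf.stalk w :=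
  V.presheaf.germ (S.U' H hv) w hw (S.sec H hv k)

/-- At `v` the germs are the boundary germs `b v k`. [folklore] -/
theorem tw_self (H : S.EndHyp) {v : V} (hv : v ∈ S.tor) (k : Fin (S.nC v + 1)) :
    S.tw H hv v (S.mem_U' H hv) k = S.b H hv k :=
  (S.chartNhd_spec H hv).2.1 k

/-- **The germ `tw_k` generates the stalk of `divOf k` at `w`.** [folklore] -/
theorem stalkIdeal_divOf_eq_span_tw (H : S.EndHyp) {v : V} (hv : v ∈ S.tor) (w : V)
    (hw : w ∈ S.U' H hv) (k : Fin (S.nC v + 1)) :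
    stalkIdeal (S.divOf H.endCond hv k).1 w = Ideal.span {S.tw H hv w hw k} :=
  ((S.chartNhd_spec H hv).2.2 k w hw).1

/-- **`w ∈ divOf k ↔ tw_k ∈ 𝔪_w`.** [folklore] -/
theorem mem_support_divOf_iff (H : S.EndHyp) {v : V} (hv : v ∈ S.tor) (w : V) (hw : w ∈ S.U' H hv)
    (k : Fin (S.nC v + 1)) :
    w ∈ (S.divOf H.endCond hv k).1.support ↔ S.tw H hv w hw k ∈ maximalIdeal (V.presheaf.stalk w) :=
  ((S.chartNhd_spec H hv).2.2 k w hw).2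

/-- The boundary sections are nonzero. [folklore] -/
theorem sec_ne_zero (H : S.EndHyp) {v : V} (hv : v ∈ S.tor) (k : Fin (S.nC v + 1)) :
    S.sec H hv k ≠ 0 := fun h =>
  S.b_ne_zero H hv k (by rw [← S.tw_self H hv k, tw, h, map_zero])

/-- Their germs are nonzero. [folklore] -/
theorem tw_ne_zero (H : S.EndHyp) {v : V} (hv : v ∈ S.tor) (w : V) (hw : w ∈ S.U' H hv)
    (k : Fin (S.nC v + 1)) : S.tw H hv w hw k ≠ 0 := by
  rw [tw, Ne, ← map_zero (V.presheaf.germ (S.U' H hv) w hw).hom]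
  exact fun h => S.sec_ne_zero H hv k (germ_injective_of_isIntegral _ w hw h)

/-- The value `uC_k ∈ L` of the boundary section `sec k`. [folklore] -/
def uC (S : GameState p V₀ L V π) (H : S.EndHyp) {v : V} (hv : v ∈ S.tor) (k : Fin (S.nC v + 1)) : L :=
  algebraMap V.functionField L (V.germToFunctionField (S.U' H hv) (S.sec H hv k))

/-- **`uC_k` is the image of the germ `tw_k` at any `w ∈ U' v`.** [folklore] -/
theorem uC_eq_algebraMap_tw (H : S.EndHyp) {v : V} (hv : v ∈ S.tor) (w : V) (hw : w ∈ S.U' H hv)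
    (k : Fin (S.nC v + 1)) : S.uC H hv k = algebraMap (V.presheaf.stalk w) L (S.tw H hv w hw k) := by
  rw [uC, IsScalarTower.algebraMap_apply (V.presheaf.stalk w) V.functionField L, tw,
    Scheme.algebraMap_germ_eq_germToFunctionField]

/-- `uC_k` through `Γ(V, U' v) → L`. [folklore] -/
theorem uC_eq_algebraMap_sec (H : S.EndHyp) {v : V} (hv : v ∈ S.tor) (k : Fin (S.nC v + 1)) :
    S.uC H hv k = algebraMap Γ(V, S.U' H hv) L (S.sec H hv k) :=
  rfl

/-- The germs are nonzero in `L`. [folklore] -/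
theorem algebraMap_tw_ne_zero (H : S.EndHyp) {v : V} (hv : v ∈ S.tor) (w : V) (hw : w ∈ S.U' H hv)
    (k : Fin (S.nC v + 1)) : algebraMap (V.presheaf.stalk w) L (S.tw H hv w hw k) ≠ 0 := by
  rw [← S.uC_eq_algebraMap_tw H hv w hw k, uC, map_ne_zero_iff _ (algebraMap V.functionField L).injective,
    Ne, ← map_zero (V.germToFunctionField (S.U' H hv)).hom]
  exact fun h => S.sec_ne_zero H hv k (V.germToFunctionField_injective _ h)

/-- The `uC_k` are nonzero. [folklore] -/
theorem uC_ne_zero (H : S.EndHyp) {v : V} (hv : v ∈ S.tor) (k : Fin (S.nC v + 1)) :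
    S.uC H hv k ≠ 0 := by
  rw [S.uC_eq_algebraMap_tw H hv v (S.mem_U' H hv) k]
  exact S.algebraMap_tw_ne_zero H hv v _ k

/-- **The Kummer relation `yN^p = ∏ uC_k^{aK k}` in `L`.** [folklore] -/
theorem yN_pow_uC (H : S.EndHyp) {v : V} (hv : v ∈ S.tor) :
    S.yN H hv ^ p = ∏ k, S.uC H hv k ^ S.aK H hv k := by
  rw [S.yN_pow H hv, map_prod]
  refine Finset.prod_congr rfl fun k _ => ?_
  rw [map_pow, S.uC_eq_algebraMap_tw H hv v (S.mem_U' H hv) k, S.tw_self H hv k]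

/-- **`yN^p = ∏ (tw_k)^{aK k}` through `𝒪_{V,w} → L`** for every `w ∈ U' v`. [folklore] -/
theorem yN_pow_tw (H : S.EndHyp) {v : V} (hv : v ∈ S.tor) (w : V) (hw : w ∈ S.U' H hv) :
    S.yN H hv ^ p = algebraMap (V.presheaf.stalk w) L (∏ k, S.tw H hv w hw k ^ S.aK H hv k) := by
  rw [S.yN_pow_uC H hv, map_prod]
  refine Finset.prod_congr rfl fun k _ => ?_
  rw [map_pow, S.uC_eq_algebraMap_tw H hv w hw k]

/-! ## The Kummer chart of `v`: values in `L` and sections of `V^L` -/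

/-- **The Kummer chart of the toroidal point `v` with values in `L`**:
`c ↦ yN^{c₀} ∏_{k ≠ 0} uC_k^{c_k}`. [folklore] -/
def kΦ (S : GameState p V₀ L V π) (H : S.EndHyp) {v : V} (hv : v ∈ S.tor) :
    Multiplicative (kummerMonoid p (S.aK H hv)) →* L :=
  kummerChart p (S.aK H hv) (S.yN H hv) (S.uC H hv) (S.yN_ne_zero H hv) (S.uC_ne_zero H hv)

/-- The chart values are integral over `Γ(V, U' v)`. [folklore] -/
theorem isIntegral_kΦ (H : S.EndHyp) {v : V} (hv : v ∈ S.tor)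
    (c : Multiplicative (kummerMonoid p (S.aK H hv))) : IsIntegral Γ(V, S.U' H hv) (S.kΦ H hv c) := by
  refine IsIntegral.of_pow H.prime.pos ?_
  rw [kΦ, kummerChart_apply, kummerChartFun_pow_of_mem p _ _ _ (S.uC_ne_zero H hv) (S.yN_pow_uC H hv)
    (Multiplicative.toAdd c).2]
  have h : ∏ k, S.uC H hv k ^ (kummerWeight p (S.aK H hv)
      ((Multiplicative.toAdd c : kummerMonoid p (S.aK H hv)) : Fin (S.nC v + 1) → ℤ) k).toNat =
      algebraMap Γ(V, S.U' H hv) L (∏ k, S.sec H hv k ^ (kummerWeight p (S.aK H hv)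
        ((Multiplicative.toAdd c : kummerMonoid p (S.aK H hv)) : Fin (S.nC v + 1) → ℤ) k).toNat) := by
    rw [map_prod]
    exact Finset.prod_congr rfl fun k _ => by rw [map_pow, ← S.uC_eq_algebraMap_sec H hv k]
  rw [h]
  exact isIntegral_algebraMap

/-- **The Kummer chart of `v` by sections of the normalisation** over `ι⁻¹ (U' v)`. [folklore] -/
def kφ (S : GameState p V₀ L V π) (H : S.EndHyp) {v : V} (hv : v ∈ S.tor) :
    Multiplicative (kummerMonoid p (S.aK H hv)) →*
      Γ(normalizationIn V L, normalizationInι V L ⁻¹ᵁ S.U' H hv) :=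
  liftToSections (S.isAffineOpen_U' H hv) (S.kΦ H hv) (S.isIntegral_kΦ H hv)

/-- **The germ of `kφ v c` at `x` has value `kΦ v c` in `L`.** [folklore] -/
theorem stalkToField_germ_kφ (H : S.EndHyp) {v : V} (hv : v ∈ S.tor) (x : normalizationIn V L)
    (hx : x ∈ normalizationInι V L ⁻¹ᵁ S.U' H hv) (c : Multiplicative (kummerMonoid p (S.aK H hv))) :
    stalkToField V L x ((normalizationIn V L).presheaf.germ (normalizationInι V L ⁻¹ᵁ S.U' H hv) x hx
      (S.kφ H hv c)) = S.kΦ H hv c := by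
  rw [stalkToField_germ]
  exact sectionToField_liftToSections (S.isAffineOpen_U' H hv) _ _ c

end GameState

/-- `v` lies in its chart domain (explicit-binder form, the registered interface of this helper
file). [folklore] -/
theorem gameState_mem_U' {p : ℕ} {V₀ : Scheme.{0}} [IsIntegral V₀] {L : Type} [Field L]
    [Algebra V₀.functionField L] {V : Scheme.{0}} [IsIntegral V] {π : V ⟶ V₀} [IsDominant π]
    (S : GameState p V₀ L V π) [Algebra V.functionField L] (H : S.EndHyp) {v : V} (hv : v ∈ S.tor) :
    v ∈ S.U' H hv :=
  S.mem_U' H hv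

end Summit.ResolutionOfSingularities.ResolutionOfSingularities.Theorems.RadicialJung.CleanModelsSuffice

end
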